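import Mathlib
import HarnessLib
import Summits.HubbardSuperconductivity.HubbardSuperconductivity.Theorems.KLProgrammeC4aVertexSecondOrderSplit
import Summits.HubbardSuperconductivity.HubbardSuperconductivity.Theorems.KLProgrammeKLRegimeTwoPointAssemblyDiag
import Literature.MathematicalPhysics.QuantumLattice.HubbardUVSymbolCTDifferences

/-!
# Route `KLProgramme` — crux C4a, S1 (c) in the MODEL's currency: the tadpole vertex of `𝒱_n` at lattice momenta to second order, the lines being the
# ultraviolet symbols `Ψ_n = uvSymbolCT … Λ_n` — units done ONCE

Cell `gate-hubbard-kl`, lane hubbard-kl-c4a-1 (g6); helper for stub (C) `stub_twoLeg_curvature` of the engine-flow child `KLRegimeEngineV17F2`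
(stmt-HubbardSuperconductivity-20437); memo HOME/hubbard-kl-c4a-1/C4A-PLAN.md §22.4 (units owed) and §23.2 (intensive form).  The hard line of the scale-`n` action is
`contr C^K_{>Λ_n} = diagContr Ψ_n`, `Ψ_n(p) = uvSymbolCT L M β μ K Λ_n (p, ·) = w^K_{Λ_n}(p)·βL²·(iω_p + e_K(p⃗))/(ω_p² + e_K(p⃗)²)` — the tree's ultraviolet
symbol (Literature `HubbardUVSymbolCTDifferences`, the restriction of the continuum `uvSymbolFn (βL²) Λ_n`, whose band jets are `HubbardUVSymbolJets`):

* §1 `contr_klHardCov_eq_diagContr_uvSymbolCT`;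
* §2 **`tadpoleVertex_klEffectiveAction_latticeMomentum`** (`β ≠ 0`): with `c_U = U(βL²)⁻³(4!)⁻¹` evaluated, `K_κ = (κ,k⃗)`, `κ ∈ {ω₀,−ω₀}`, `Q = (p₀,q⃗)`, `H_n = Σ_p Ψ_n(p)`,
  `tadpoleVertex β 𝒱_n p₀ (p_k⃗) (p_q⃗) = −U/(β²L²) − U²/(2β⁵L⁸)·Σ_κ [Σ_pΨ_n(p)² − S_pp(K_κ,Q) − 2S_ph(K_κ,Q)]`
  `+ U/(β³L⁴)·Σ_κ [Ψ_n(K_κ)·(K(p_k⃗) − U/(β²L⁴)·H_n) + Ψ_n(Q)·(K(p_q⃗) − U/(β²L⁴)·H_n)] + tadpoleVertex β T₃,n p₀ (p_k⃗) (p_q⃗)`,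
  `S_pp(K,Q) = Σ_{p,p′}[n_p+n_p′ = n_K+n_Q ∧ p⃗+p⃗′ = k⃗+q⃗]ΨΨ′`, `S_ph(K,Q) = Σ_{p,p′}[n_p+n_Q = n_p′+n_K ∧ p⃗+q⃗ = p⃗′+k⃗]ΨΨ′`.
  INTENSIVE READING (`Ψ = βL²·wĝ`): `−U/(β²L²)·{1 + (U/2)·Σ_κ[𝔅₀ − 𝔅_pp − 2𝔅_ph] − Σ_κ[wĝ(K_κ)(K(p_k⃗) − U·n_{>Λ_n}) + wĝ(Q)(K(p_q⃗) − U·n_{>Λ_n})]} + T₃`,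
  `𝔅 = (βL²)⁻¹Σ wĝ·wĝ′`, `n_{>Λ} = (βL²)⁻¹Σ_p wĝ` — pp screens a repulsive `U` in the Cooper channel.

Exact algebra; nothing about sizes; nothing asserts superconductivity.  References: Salmhofer 1999 §2.4, §4.2.5 [cite: Salmhofer1999]; BGM 2006 §2.3 [cite: BenfattoGiulianiMastropietro2006].
-/

noncomputable section

namespace Summit.HubbardSuperconductivity.HubbardSuperconductivity.Theorems.C4a

set_option linter.dupNamespace false -- summit = problem name (single-conjunct summit), D-0017

open Literature.MathematicalPhysics.QuantumLattice Literature.Probability.LatticeModels GrassmannAlgebra Finset Matrix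
open Summit.HubbardSuperconductivity.HubbardSuperconductivity.Theorems.KLRegimeWick
open Summit.HubbardSuperconductivity.HubbardSuperconductivity.Theorems.KLRegimeSplit
open Summit.HubbardSuperconductivity.HubbardSuperconductivity.Theorems.KLProgrammeLegKernels
open Summit.HubbardSuperconductivity.HubbardSuperconductivity.Theorems.TwoPointAssembly

variable {L M : ℕ} [NeZero L] [NeZero M]

/-! ## §1 The hard line is the ultraviolet symbol -/

omit [NeZero M] in
/-- **`contr C^K_{>Λ_n} = diagContr Ψ_n`**, `Ψ_n(p) = uvSymbolCT L M β μ K Λ_n (p, 0)` (the spin slot of `uvSymbolCT` is idle). [cite: Salmhofer1999, §4.2.5 (4.70)] -/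
theorem contr_klHardCov_eq_diagContr_uvSymbolCT {β : ℝ} (hβ : β ≠ 0) (μ : ℝ) (K : TrigPolyC4v) (n : ℕ) :
    contr ℂ (klHardCov L M β μ K n) = diagContr L M fun p => uvSymbolCT L M β μ K (klScale klE0 n) (p, 0) := by
  rw [contr_klHardCov_eq_diagContr hβ μ K n]
  congr 1
  funext p
  rw [uvSymbolCT, propCT_eq_div_nambuDenCT hβ μ K p]

/-! ## §2 The tadpole vertex of `𝒱_n` at lattice momenta, to second order, in the model's currency -/

/-- **THE TADPOLE VERTEX OF `𝒱_n` AT LATTICE MOMENTA TO SECOND ORDER, units evaluated** (`β ≠ 0`; `Ψ = uvSymbolCT L M β μ K Λ_n (·, 0)`, `H = Σ_p Ψ(p)`,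
`K_κ = (κ, k⃗)`, `Q = (p₀, q⃗)`, `T₃ = 𝒱_n − e^{Δ_C}W + ½(e^{Δ_C}(WW) − (e^{Δ_C}W)²)`):
`tadpoleVertex β 𝒱_n p₀ (p_k⃗)(p_q⃗) = −U/(β²L²) − U²/(2β⁵L⁸)·Σ_κ[Σ_pΨ² − S_pp − 2S_ph] + U/(β³L⁴)·Σ_κ[Ψ(K_κ)(K(p_k⃗) − U/(β²L⁴)·H) + Ψ(Q)(K(p_q⃗) − U/(β²L⁴)·H)] + tadpoleVertex β T₃ …`.
[cite: Salmhofer1999, §2.4] -/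
theorem tadpoleVertex_klEffectiveAction_latticeMomentum {β : ℝ} (hβ : β ≠ 0) (U μ : ℝ) (K : TrigPolyC4v) (n : ℕ) (p₀ : MatsubaraIdx M)
    (k q : TorusSite 2 L) :
    tadpoleVertex β (klEffectiveAction L M β U μ K klE0 n) p₀ (WithLp.toLp 2 (latticeMomentum L k)) (WithLp.toLp 2 (latticeMomentum L q)) =
      (((-(U / (β ^ 2 * (L : ℝ) ^ 2))) : ℝ) : ℂ) -
        ((U ^ 2 / (2 * β ^ 5 * (L : ℝ) ^ 8) : ℝ) : ℂ) * ∑ κ : Fin 2,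
          (∑ p : FreqMomentum L M, uvSymbolCT L M β μ K (klScale klE0 n) (p, 0) * uvSymbolCT L M β μ K (klScale klE0 n) (p, 0) -
            ∑ p : FreqMomentum L M, ∑ p' : FreqMomentum L M,
              (if matsubaraInt M p.1 + matsubaraInt M p'.1 =
                    matsubaraInt M ((![omega0 M, (omega0 M).rev] : Fin 2 → MatsubaraIdx M) κ) + matsubaraInt M p₀ ∧ p.2 + p'.2 = k + q then
                uvSymbolCT L M β μ K (klScale klE0 n) (p, 0) * uvSymbolCT L M β μ K (klScale klE0 n) (p', 0) else 0) -
            2 * ∑ p : FreqMomentum L M, ∑ p' : FreqMomentum L M,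
              (if matsubaraInt M p.1 + matsubaraInt M p₀ = matsubaraInt M p'.1 + matsubaraInt M ((![omega0 M, (omega0 M).rev] : Fin 2 → MatsubaraIdx M) κ) ∧
                    p.2 + q = p'.2 + k then
                uvSymbolCT L M β μ K (klScale klE0 n) (p, 0) * uvSymbolCT L M β μ K (klScale klE0 n) (p', 0) else 0)) +
        ((U / (β ^ 3 * (L : ℝ) ^ 4) : ℝ) : ℂ) * ∑ κ : Fin 2,
          (uvSymbolCT L M β μ K (klScale klE0 n) ((((![omega0 M, (omega0 M).rev] : Fin 2 → MatsubaraIdx M) κ), k), 0) *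
              ((K.eval (latticeMomentum L k) : ℂ) - ((U / (β ^ 2 * (L : ℝ) ^ 4) : ℝ) : ℂ) * ∑ p : FreqMomentum L M, uvSymbolCT L M β μ K (klScale klE0 n) (p, 0)) +
            uvSymbolCT L M β μ K (klScale klE0 n) ((p₀, q), 0) *
              ((K.eval (latticeMomentum L q) : ℂ) - ((U / (β ^ 2 * (L : ℝ) ^ 4) : ℝ) : ℂ) * ∑ p : FreqMomentum L M, uvSymbolCT L M β μ K (klScale klE0 n) (p, 0))) +
        tadpoleVertex β (klEffectiveAction L M β U μ K klE0 n - gaussConv ℂ (klHardCov L M β μ K n) (hubbardInteractionCT L M β U K) +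
          (2 : ℂ)⁻¹ • (gaussConv ℂ (klHardCov L M β μ K n) (hubbardInteractionCT L M β U K * hubbardInteractionCT L M β U K) -
            gaussConv ℂ (klHardCov L M β μ K n) (hubbardInteractionCT L M β U K) * gaussConv ℂ (klHardCov L M β μ K n) (hubbardInteractionCT L M β U K))) p₀
          (WithLp.toLp 2 (latticeMomentum L k)) (WithLp.toLp 2 (latticeMomentum L q)) := by
  have hL : (L : ℂ) ≠ 0 := Nat.cast_ne_zero.2 (NeZero.ne L)
  have hβ' : (β : ℂ) ≠ 0 := Complex.ofReal_ne_zero.2 hβ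
  -- the dressed two-leg kernel on the reciprocal pair: frame + Hartree, `H = Σ_p Ψ(p)` (the hard line IS the ultraviolet symbol)
  have h2 : ∀ (p : FreqMomentum L M) (s : Fin 2),
      kernel ℂ (gaussConv ℂ (klHardCov L M β μ K n) (hubbardInteractionCT L M β U K)) 2 ![((p, s), 0), ((p, s), 1)] =
        ((K.eval (latticeMomentum L p.2) / (β * (L : ℝ) ^ 2) : ℝ) : ℂ) * (((2 : ℕ).factorial : ℚ)⁻¹ • (1 : ℂ)) -
          12 * ((((U / (β * (L : ℝ) ^ 2) ^ 3 : ℝ)) : ℂ) * (((4 : ℕ).factorial : ℚ)⁻¹ • (1 : ℂ))) *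
            ∑ p' : FreqMomentum L M, uvSymbolCT L M β μ K (klScale klE0 n) (p', 0) :=
    fun p s => kernel_two_gaussConv_hubbardInteractionCT_plus_minus β U μ K (klScale klE0 n) p s
  rw [tadpoleVertex_klEffectiveAction_split hβ,
    tadpoleVertex_secondCumulant_latticeMomentum U K hβ (contr_klHardCov_eq_diagContr_uvSymbolCT hβ μ K n) p₀ k q]
  simp_rw [h2]
  simp only [Fin.sum_univ_two, Fin.isValue]
  have h24 : (((4 : ℕ).factorial : ℚ)⁻¹ • (1 : ℂ)) = (24 : ℂ)⁻¹ := by rw [Rat.smul_one_eq_cast]; norm_num [Nat.factorial]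
  have h2' : (((2 : ℕ).factorial : ℚ)⁻¹ • (1 : ℂ)) = (2 : ℂ)⁻¹ := by rw [Rat.smul_one_eq_cast]; norm_num [Nat.factorial]
  rw [h24, h2']
  push_cast
  field_simp
  ring

end Summit.HubbardSuperconductivity.HubbardSuperconductivity.Theorems.C4a

end
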